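/-
Copyright (c) 2026 the pub-hodgecm-mathlib formalisation cell (harness21).  Prover seat hodgecm-mathlib-K2Liu-p02 (g0): Track B «K2-LIT», #184♮ = hLiu418,
organ O41.1 PART B1 of socket #41 `sig_K2LiuSiegelEisensteinContinuation` (U6; steward K2Liu-p01 (g0) «B1 next», 2026-09-03T22:54:55Z).
-/
import Summits.HodgeConjecture.HodgeConjecture.Theorems.K2LiuSiegelBruhatCells
import HarnessLib

/-!
# Crux `HLiu418`, Track B road `K2_Liu`, unit U6, organ O41.1 (PART B1): UNITARITY OF THE BIG-CELL FACTORS —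
# the `N_Δ`-coordinate `X = C⁻¹D − ⅟2` of a UNITARY big-cell element satisfies `J X + X^* J = 0`, i.e. `(1 X; 0 1) ∈ U`

Cell `hodgecm-mathlib`, crux item hLiu418 = `stmt-HodgeConjecture-24832`; prover K2Liu-p02 (g0) for steward K2Liu-p01 (g0) (O41.1: «B1 unitarity of the factors
first — without it the cells are GL-cells, and O41.4 lives in H(F)»).  THEOREMS ONLY, imports ★ PART A (`K2LiuSiegelBruhatCells`, Mathlib-only), lane
`--supports stmt-HodgeConjecture-24832 --as helper`.

SETTING (as ★ H4a `K2LiuDoublingUnfoldMainOrbitBlocks`): a commutative ring `L` (§§1–4; a field in §5) with a ring endomorphism `c` (complex conjugation), an index type `ι`, an INVERTIBLE Gram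
matrix `J ∈ M_ι(L)`, the doubled form `J^𝔻 = diag(J, −J)` on `ι ⊕ ι`, read in the TRIANGULAR FRAME of ★ `DoubledUnitarySiegelParabolicAlgebra.conjE_eq`
(`F = E₁ M E₂`, `E₂ = (1 0; 1 1)`): the frame form is `J_F := ᵗE₂ J^𝔻 E₂ = (0 −J; −J −J)` (`frameForm_eq`), for which `Δ` (first block) is isotropic.
`M^* := ᵗ(c M)`.  A frame matrix `F` is UNITARY when `F^* J_F F = J_F`.

* §1 `frameForm_eq`; `conjTranspose_fromBlocks` (`(A B; C D)^* = (A^* C^*; B^* D^*)`).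
* §2 `unip_unitary_iff` — **`n(X) = (1 X; 0 1)` is unitary iff `J X + X^* J = 0`** (the `N_Δ(F)` of the unitary group: `J`-skew-hermitian coordinates);
  `unip_mul_unip`, `unip_mul_unip_neg` (`n(X) n(Y) = n(X+Y)`, `n(X)⁻¹ = n(−X)`); `weyl_map`, `weyl_mul_weyl` (`W² = 1`), `weyl_unitary` — the frame
  `W = (1 0; −2 −1)` of `w_Δ` (★ PART A) is unitary.
* §3 `frameForm_mul_frameInv` / `frameInv_mul_frameForm` (`J_F⁻¹ = (J⁻¹ −J⁻¹; −J⁻¹ 0)`); `mul_frameInv_mul_conjTranspose` — a unitary `F` also satisfies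
  the ROW relations `F J_F⁻¹ F^* = J_F⁻¹`; its `(2,2)` block is `C J⁻¹ C^* = D J⁻¹ C^* + C J⁻¹ D^*` (`lowerRow_relation`).
* §4 **`unipCoordinate_skew`** — for a UNITARY frame matrix `(A B; C D)` with `C` invertible (and `2 ∈ L^×`), the `N_Δ`-coordinate of ★ `bigCell_eq`,
  `X = C⁻¹ D − ⅟2`, satisfies `J X + X^* J = 0`; hence `unip_unitary_of_bigCell` (the factor `n(X)` is unitary), `unip_neg_unitary`, and
  **`siegelFactor_unitary`**: if `F = p W n(X)` with `F` unitary and `X` skew then the Siegel factor `p = F n(−X) W` is unitary — the big GL-cell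
  `P W N` of PART A meets the unitary group in `P_H(F) w_Δ N_Δ(F)` [GPSR87 Part A §§1–2].
* §5 (cells exhaust, over a field) `rank_toBlocks₂₁_le` (`rank C ≤ n`), `isUnit_det_iff_rank_eq_card` (big cell = rank `n`), `rank_eq_zero_iff`
  (small cell = rank `0`); for `n = 2` one middle cell (rank `1`) remains — its parametrisation is PART B2 (with O41.4).

HONEST LABEL.  Count-neutral helper; `HC_CM` is proved only modulo the 7 printed citations (hLiu418 = 24832, h413 = 24833) until rung 0 closes.

## References
* [GelbartPiatetskishapiroRallis1987] S. Gelbart, I. Piatetski-Shapiro, S. Rallis, LNM 1254 (1987), Part A §§1–2.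
* [KudlaRallis1994] S. Kudla, S. Rallis, Ann. Math. 140 (1994), §1.
-/

namespace Summit.HodgeConjecture.HodgeConjecture.Cruxes.HLiu418.K2LiuSiegelBruhatCellsUnitary

open Matrix

section CommRing

/-! ED. 2 (same seat, +15 min, no importers yet): §§1–4 hold over any COMMUTATIVE RING `L` with a ring endomorphism `c` (ED. 1 said `Field`) — the
adelic lift to `H(𝔸) ≤ GL_{n+n}(𝔸_L)` (★ `UnitaryGroup.adelic = unitaryGroupOfForm (conjAdele …) J`, i.e. `(g.map c)ᵀ J g = J` over `𝔸_L`) needs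
exactly this generality; §5 (ranks) stays over a field. Names and conclusions unchanged. -/

variable {L : Type*} [CommRing L] (c : L →+* L) {ι : Type*} [Fintype ι] [DecidableEq ι]

/-! ## §1 The frame form and conjugate transposes of block matrices -/

omit [Fintype ι] [DecidableEq ι] in
/-- `(A B; C D)^* = (A^* C^*; B^* D^*)` for `M^* = ᵗ(c M)`. [folklore] -/
theorem conjTranspose_fromBlocks (A B C D : Matrix ι ι L) :
    ((fromBlocks A B C D).map c)ᵀ = fromBlocks ((A.map c)ᵀ) ((C.map c)ᵀ) ((B.map c)ᵀ) ((D.map c)ᵀ) := by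
  rw [fromBlocks_map, fromBlocks_transpose]

/-- **The frame form**: `ᵗE₂ · diag(J, −J) · E₂ = (0 −J; −J −J)` for `E₂ = (1 0; 1 1)` — the doubled hermitian form in the triangular frame,
for which the first block (`Δ`) is totally isotropic. [cite: GelbartPiatetskishapiroRallis1987, Part A §1] -/
theorem frameForm_eq (J : Matrix ι ι L) :
    (fromBlocks (1 : Matrix ι ι L) 0 1 1)ᵀ * fromBlocks J 0 0 (-J) * fromBlocks 1 0 1 1 = fromBlocks 0 (-J) (-J) (-J) := by
  rw [fromBlocks_transpose, transpose_one, transpose_zero, fromBlocks_multiply, fromBlocks_multiply]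
  simp only [Matrix.one_mul, Matrix.mul_one, Matrix.zero_mul, Matrix.mul_zero, add_zero, zero_add]
  rw [fromBlocks_inj]
  exact ⟨by rw [add_neg_cancel], rfl, rfl, rfl⟩

/-! ## §2 `N_Δ(F)` and `w_Δ` inside the unitary group -/

/-- **`(1 X; 0 1)` is unitary for the frame form iff `J X + X^* J = 0`** (`X` is `J`-skew-hermitian): the unipotent radical `N_Δ(F)` of the Siegel
parabolic of `U(J ⊕ −J)` in coordinates. [cite: GelbartPiatetskishapiroRallis1987, Part A §1] -/
theorem unip_unitary_iff (J X : Matrix ι ι L) :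
    ((fromBlocks 1 X 0 1).map c)ᵀ * fromBlocks 0 (-J) (-J) (-J) * fromBlocks 1 X 0 1 = fromBlocks 0 (-J) (-J) (-J) ↔
      J * X + (X.map c)ᵀ * J = 0 := by
  rw [conjTranspose_fromBlocks, Matrix.map_one _ (map_zero c) (map_one c), Matrix.map_zero _ (map_zero c), transpose_one, transpose_zero,
    fromBlocks_multiply, fromBlocks_multiply]
  simp only [Matrix.one_mul, Matrix.mul_one, Matrix.zero_mul, Matrix.mul_zero, add_zero, zero_add, Matrix.mul_neg, Matrix.neg_mul, neg_zero]
  rw [fromBlocks_inj]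
  constructor
  · rintro ⟨-, -, -, h⟩
    -- h : -(J X) + (-(X^* J) + -J) = -J
    have h2 : J * X + (X.map c)ᵀ * J = -(-(J * X) + (-((X.map c)ᵀ * J) + -J)) - J := by abel
    rw [h2, h, neg_neg, sub_self]
  · intro h
    refine ⟨rfl, rfl, rfl, ?_⟩
    have h' : (X.map c)ᵀ * J = -(J * X) := eq_neg_of_add_eq_zero_right h
    rw [h', neg_neg]
    abel

/-- `n(X) · n(Y) = n(X + Y)`: the unipotent frame matrices form an additive one-parameter family. [folklore] -/
theorem unip_mul_unip (X Y : Matrix ι ι L) : fromBlocks 1 X 0 1 * fromBlocks 1 Y 0 1 = (fromBlocks 1 (X + Y) 0 1 : Matrix (ι ⊕ ι) (ι ⊕ ι) L) := by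
  rw [fromBlocks_multiply]
  simp only [Matrix.one_mul, Matrix.mul_one, Matrix.zero_mul, Matrix.mul_zero, add_zero, zero_add]
  rw [add_comm Y X]

/-- `n(X) · n(−X) = 1`. [folklore] -/
theorem unip_mul_unip_neg (X : Matrix ι ι L) : fromBlocks 1 X 0 1 * fromBlocks 1 (-X) 0 1 = (1 : Matrix (ι ⊕ ι) (ι ⊕ ι) L) := by
  rw [unip_mul_unip, add_neg_cancel, fromBlocks_one]

omit [Fintype ι] in
/-- The frame `W = (1 0; −2 −1)` of `w_Δ` has integer entries, so the ring endomorphism `c` fixes it. [folklore] -/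
theorem weyl_map : (fromBlocks 1 0 (-2) (-1) : Matrix (ι ⊕ ι) (ι ⊕ ι) L).map c = (fromBlocks 1 0 (-2) (-1) : Matrix (ι ⊕ ι) (ι ⊕ ι) L) := by
  rw [K2LiuSiegelBruhatCells.two_eq_smul_one]
  ext i j
  rcases i with i | i <;> rcases j with j | j <;>
    simp [Matrix.one_apply, apply_ite c, map_ofNat c 2]

/-- `W² = 1` for the frame `W = (1 0; −2 −1)` of `w_Δ` (so `W⁻¹ = W`). [folklore] -/
theorem weyl_mul_weyl :
    (fromBlocks 1 0 (-2) (-1) : Matrix (ι ⊕ ι) (ι ⊕ ι) L) * (fromBlocks 1 0 (-2) (-1) : Matrix (ι ⊕ ι) (ι ⊕ ι) L) = 1 := by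
  rw [K2LiuSiegelBruhatCells.two_eq_smul_one, fromBlocks_multiply]
  simp only [Matrix.one_mul, Matrix.mul_one, Matrix.zero_mul, Matrix.mul_zero, Matrix.mul_neg, Matrix.neg_mul, neg_neg, neg_add_cancel,
    neg_zero, add_zero, zero_add, fromBlocks_one]

/-- **The frame `W = (1 0; −2 −1)` of `w_Δ` is unitary** for the frame form. [cite: GelbartPiatetskishapiroRallis1987, Part A §1] -/
theorem weyl_unitary (J : Matrix ι ι L) :
    ((fromBlocks 1 0 (-2) (-1) : Matrix (ι ⊕ ι) (ι ⊕ ι) L).map c)ᵀ * fromBlocks 0 (-J) (-J) (-J) *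
        (fromBlocks 1 0 (-2) (-1) : Matrix (ι ⊕ ι) (ι ⊕ ι) L) =
      fromBlocks 0 (-J) (-J) (-J) := by
  rw [weyl_map c, K2LiuSiegelBruhatCells.two_eq_smul_one, fromBlocks_transpose, transpose_one, transpose_zero, transpose_neg, transpose_neg,
    transpose_one, transpose_smul, transpose_one, fromBlocks_multiply, fromBlocks_multiply]
  simp only [Matrix.one_mul, Matrix.mul_one, Matrix.zero_mul, Matrix.mul_zero, zero_add, Matrix.mul_neg, Matrix.neg_mul, neg_neg,
    Matrix.smul_mul, Matrix.mul_smul, neg_zero]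
  rw [fromBlocks_inj]
  refine ⟨?_, ?_, ?_, ?_⟩ <;> (try simp only [two_smul]) <;> abel

/-! ## §3 The row relations of a unitary frame matrix -/

/-- The inverse of the frame form: `(0 −J; −J −J) · (J⁻¹ −J⁻¹; −J⁻¹ 0) = 1`. [folklore] -/
theorem frameForm_mul_frameInv (J : Matrix ι ι L) (hJ : IsUnit J.det) :
    fromBlocks 0 (-J) (-J) (-J) * fromBlocks J⁻¹ (-J⁻¹) (-J⁻¹) 0 = (1 : Matrix (ι ⊕ ι) (ι ⊕ ι) L) := by
  rw [fromBlocks_multiply]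
  simp only [Matrix.zero_mul, Matrix.mul_zero, Matrix.neg_mul, Matrix.mul_neg, neg_neg, Matrix.mul_nonsing_inv _ hJ, zero_add, add_zero,
    neg_add_cancel, neg_zero, fromBlocks_one]

/-- `(J⁻¹ −J⁻¹; −J⁻¹ 0) · (0 −J; −J −J) = 1`. [folklore] -/
theorem frameInv_mul_frameForm (J : Matrix ι ι L) (hJ : IsUnit J.det) :
    fromBlocks J⁻¹ (-J⁻¹) (-J⁻¹) 0 * fromBlocks 0 (-J) (-J) (-J) = (1 : Matrix (ι ⊕ ι) (ι ⊕ ι) L) :=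
  mul_eq_one_comm.mp (frameForm_mul_frameInv J hJ)

/-- **Row relations.** A unitary frame matrix `F` (`F^* J_F F = J_F`) also satisfies `F J_F⁻¹ F^* = J_F⁻¹` (for `J` invertible): `J_F⁻¹ F^* J_F` is a
left inverse of `F`, hence a right inverse. [cite: GelbartPiatetskishapiroRallis1987, Part A §1] -/
theorem mul_frameInv_mul_conjTranspose (J : Matrix ι ι L) (hJ : IsUnit J.det) (F : Matrix (ι ⊕ ι) (ι ⊕ ι) L)
    (hF : (F.map c)ᵀ * fromBlocks 0 (-J) (-J) (-J) * F = fromBlocks 0 (-J) (-J) (-J)) :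
    F * fromBlocks J⁻¹ (-J⁻¹) (-J⁻¹) 0 * (F.map c)ᵀ = fromBlocks J⁻¹ (-J⁻¹) (-J⁻¹) 0 := by
  set Φ : Matrix (ι ⊕ ι) (ι ⊕ ι) L := fromBlocks 0 (-J) (-J) (-J)
  set K : Matrix (ι ⊕ ι) (ι ⊕ ι) L := fromBlocks J⁻¹ (-J⁻¹) (-J⁻¹) 0
  have h1 : Φ * K = 1 := frameForm_mul_frameInv J hJ
  have h2 : K * Φ = 1 := frameInv_mul_frameForm J hJ
  have h3 : K * (F.map c)ᵀ * Φ * F = 1 := by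
    rw [show K * (F.map c)ᵀ * Φ * F = K * ((F.map c)ᵀ * Φ * F) by simp only [Matrix.mul_assoc], hF, h2]
  have h4 : F * (K * (F.map c)ᵀ * Φ) = 1 := mul_eq_one_comm.mp h3
  calc F * K * (F.map c)ᵀ = F * K * (F.map c)ᵀ * (Φ * K) := by rw [h1, Matrix.mul_one]
    _ = F * (K * (F.map c)ᵀ * Φ) * K := by simp only [Matrix.mul_assoc]
    _ = K := by rw [h4, Matrix.one_mul]

/-- **The `(2,2)` row relation** of a unitary frame matrix `(A B; C D)`: `C J⁻¹ C^* = D J⁻¹ C^* + C J⁻¹ D^*` (the `(2,2)` block of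
`F J_F⁻¹ F^* = J_F⁻¹`). [cite: GelbartPiatetskishapiroRallis1987, Part A §1] -/
theorem lowerRow_relation (J A B C D : Matrix ι ι L) (hJ : IsUnit J.det)
    (hF : ((fromBlocks A B C D).map c)ᵀ * fromBlocks 0 (-J) (-J) (-J) * fromBlocks A B C D = fromBlocks 0 (-J) (-J) (-J)) :
    C * J⁻¹ * (C.map c)ᵀ = D * J⁻¹ * (C.map c)ᵀ + C * J⁻¹ * (D.map c)ᵀ := by
  have h := mul_frameInv_mul_conjTranspose c J hJ _ hF
  rw [conjTranspose_fromBlocks, fromBlocks_multiply, fromBlocks_multiply] at h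
  simp only [Matrix.mul_zero, add_zero, Matrix.mul_neg, Matrix.add_mul, Matrix.neg_mul] at h
  obtain ⟨-, -, -, h22⟩ := fromBlocks_inj.mp h
  refine sub_eq_zero.mp (Eq.trans ?_ h22)
  abel

/-! ## §4 The unipotent coordinate of a unitary big-cell element is `J`-skew-hermitian -/

/-- **The unipotent coordinate of a unitary big-cell element is `J`-skew-hermitian.**  For a frame matrix `(A B; C D)` UNITARY for the frame form
`(0 −J; −J −J)` (`J` invertible) with `C` invertible, the `N_Δ`-coordinate `X = C⁻¹ D − ⅟2` of ★ `bigCell_eq` satisfies `J X + X^* J = 0`.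
Proof: the `(2,2)` row relation with `D = C Y`, `Y = C⁻¹ D`, reads `C (J⁻¹ − Y J⁻¹ − J⁻¹ Y^*) C^* = 0`; cancel `C`, `C^*` and conjugate by `J`:
`J Y + Y^* J = J`; subtract `⅟2 J + ⅟2 J = J`. [cite: GelbartPiatetskishapiroRallis1987, Part A §§1–2] [cite: KudlaRallis1994, §1] -/
theorem unipCoordinate_skew [Invertible (2 : L)] (J A B C D : Matrix ι ι L) (hJ : IsUnit J.det) (hC : IsUnit C.det)
    (hF : ((fromBlocks A B C D).map c)ᵀ * fromBlocks 0 (-J) (-J) (-J) * fromBlocks A B C D = fromBlocks 0 (-J) (-J) (-J)) :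
    J * (C⁻¹ * D - ⅟(2 : L) • 1) + ((C⁻¹ * D - ⅟(2 : L) • 1).map c)ᵀ * J = 0 := by
  have hrow := lowerRow_relation c J A B C D hJ hF
  set Y : Matrix ι ι L := C⁻¹ * D with hY
  have hD : D = C * Y := by rw [hY, Matrix.mul_nonsing_inv_cancel_left C D hC]
  rw [hD, Matrix.map_mul, Matrix.transpose_mul] at hrow
  have hCu : IsUnit C := (Matrix.isUnit_iff_isUnit_det C).mpr hC
  have hCsu : IsUnit ((C.map c)ᵀ) := by
    rw [Matrix.isUnit_iff_isUnit_det, Matrix.det_transpose, ← RingHom.mapMatrix_apply, ← RingHom.map_det]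
    exact hC.map c
  -- cancel `C` on the left and `C^*` on the right of the `(2,2)` row relation
  have key : J⁻¹ = Y * J⁻¹ + J⁻¹ * (Y.map c)ᵀ := by
    refine hCsu.mul_right_cancel (hCu.mul_left_cancel ?_)
    simpa only [Matrix.mul_assoc, Matrix.mul_add, Matrix.add_mul] using hrow
  -- conjugate by `J`
  have key2 : J * Y + (Y.map c)ᵀ * J = J := by
    have h := congrArg (fun M => J * M * J) key
    simp only [Matrix.mul_add, Matrix.add_mul, Matrix.mul_assoc, Matrix.mul_nonsing_inv_cancel_left J ((Y.map c)ᵀ * J) hJ, Matrix.nonsing_inv_mul _ hJ, Matrix.mul_one] at h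
    exact h.symm
  have hc : c (⅟(2 : L)) = ⅟(2 : L) := by
    refine (invOf_eq_left_inv ?_).symm
    calc c (⅟(2 : L)) * 2 = c (⅟(2 : L)) * c 2 := by rw [map_ofNat]
      _ = c (⅟(2 : L) * 2) := (map_mul c _ _).symm
      _ = 1 := by rw [invOf_mul_self, map_one]
  have hmap : (Y - ⅟(2 : L) • (1 : Matrix ι ι L)).map c = Y.map c - ⅟(2 : L) • 1 := by
    ext i j
    simp [Matrix.one_apply, apply_ite c, hc]
  rw [hmap, transpose_sub, transpose_smul, transpose_one, Matrix.mul_sub, Matrix.sub_mul, Matrix.mul_smul, Matrix.smul_mul, Matrix.mul_one,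
    Matrix.one_mul, show J * Y - ⅟(2 : L) • J + ((Y.map c)ᵀ * J - ⅟(2 : L) • J) = (J * Y + (Y.map c)ᵀ * J) - (⅟(2 : L) • J + ⅟(2 : L) • J) by abel,
    key2, ← add_smul, invOf_two_add_invOf_two, one_smul, sub_self]

/-- **The unipotent factor of the big cell is unitary**: for a unitary big-cell frame matrix `(A B; C D)`, the factor `n(X) = (1 X; 0 1)`,
`X = C⁻¹ D − ⅟2`, of ★ `bigCell_eq` lies in the unitary group (hence in `N_Δ(F)`). [cite: GelbartPiatetskishapiroRallis1987, Part A §§1–2] -/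
theorem unip_unitary_of_bigCell [Invertible (2 : L)] (J A B C D : Matrix ι ι L) (hJ : IsUnit J.det) (hC : IsUnit C.det)
    (hF : ((fromBlocks A B C D).map c)ᵀ * fromBlocks 0 (-J) (-J) (-J) * fromBlocks A B C D = fromBlocks 0 (-J) (-J) (-J)) :
    ((fromBlocks 1 (C⁻¹ * D - ⅟(2 : L) • 1) 0 1).map c)ᵀ * fromBlocks 0 (-J) (-J) (-J) * fromBlocks 1 (C⁻¹ * D - ⅟(2 : L) • 1) 0 1 =
      fromBlocks 0 (-J) (-J) (-J) :=
  (unip_unitary_iff c J _).mpr (unipCoordinate_skew c J A B C D hJ hC hF)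

/-- If `n(X)` is unitary then so is `n(−X) = n(X)⁻¹`. [folklore] -/
theorem unip_neg_unitary (J X : Matrix ι ι L) (hX : J * X + (X.map c)ᵀ * J = 0) :
    ((fromBlocks 1 (-X) 0 1).map c)ᵀ * fromBlocks 0 (-J) (-J) (-J) * fromBlocks 1 (-X) 0 1 = fromBlocks 0 (-J) (-J) (-J) := by
  refine (unip_unitary_iff c J _).mpr ?_
  rw [Matrix.map_neg _ (map_neg c), transpose_neg, Matrix.mul_neg, Matrix.neg_mul, ← neg_add, hX, neg_zero]

/-- **The Siegel (Levi × radical) factor of the big cell is unitary.**  If `F = p · W · n(X)` with `F` unitary and `J X + X^* J = 0` (so `n(X)` is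
unitary), then `p` is unitary: `p = F · n(−X) · W` (`n(X)⁻¹ = n(−X)`, `W⁻¹ = W`) is a product of unitary matrices.  With ★ `bigCell_eq` and
`unipCoordinate_skew`: the big GL-cell `P W N` of PART A meets the unitary group in `P_H(F) · w_Δ · N_Δ(F)`.
[cite: GelbartPiatetskishapiroRallis1987, Part A §§1–2] -/
theorem siegelFactor_unitary (J X : Matrix ι ι L) (F p : Matrix (ι ⊕ ι) (ι ⊕ ι) L)
    (hF : (F.map c)ᵀ * fromBlocks 0 (-J) (-J) (-J) * F = fromBlocks 0 (-J) (-J) (-J)) (hX : J * X + (X.map c)ᵀ * J = 0)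
    (h : F = p * (fromBlocks 1 0 (-2) (-1) : Matrix (ι ⊕ ι) (ι ⊕ ι) L) * fromBlocks 1 X 0 1) :
    (p.map c)ᵀ * fromBlocks 0 (-J) (-J) (-J) * p = fromBlocks 0 (-J) (-J) (-J) := by
  set Φ : Matrix (ι ⊕ ι) (ι ⊕ ι) L := fromBlocks 0 (-J) (-J) (-J) with hΦ
  set W : Matrix (ι ⊕ ι) (ι ⊕ ι) L := fromBlocks 1 0 (-2) (-1) with hW
  set N : Matrix (ι ⊕ ι) (ι ⊕ ι) L := fromBlocks 1 (-X) 0 1 with hN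
  have hWW : W * W = 1 := weyl_mul_weyl
  have hWu : (W.map c)ᵀ * Φ * W = Φ := weyl_unitary c J
  have hNu : (N.map c)ᵀ * Φ * N = Φ := unip_neg_unitary c J X hX
  have hp : p = F * N * W := by
    rw [h, Matrix.mul_assoc (p * W), hN, unip_mul_unip_neg, Matrix.mul_one, Matrix.mul_assoc p, hWW, Matrix.mul_one]
  rw [hp, Matrix.map_mul, Matrix.map_mul, Matrix.transpose_mul, Matrix.transpose_mul]
  calc (W.map c)ᵀ * ((N.map c)ᵀ * (F.map c)ᵀ) * Φ * (F * N * W)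
        = (W.map c)ᵀ * ((N.map c)ᵀ * ((F.map c)ᵀ * Φ * F) * N) * W := by simp only [Matrix.mul_assoc]
    _ = Φ := by rw [hF, hNu, hWu]

end CommRing

section Field

/-! ## §5 The cells exhaust (over a field): the rank of the lower-left block -/

variable {L : Type*} [Field L] {ι : Type*} [Fintype ι] [DecidableEq ι]

omit [DecidableEq ι] in
/-- Over a field the lower-left block `C` of a frame matrix has rank `≤ n = |ι|`; the cells of PART A are indexed by this rank (★ `rank_toBlocks₂₁_siegel_mul`,
★ `rank_toBlocks₂₁_mul_siegel`): rank `0` = the small cell (★ `toBlocks₂₁_eq_zero_iff`, `rank_eq_zero_iff`), rank `n` = the big cell (★ `bigCell_eq`,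
`isUnit_det_iff_rank_eq_card`); for `n = 2` exactly one middle cell (rank `1`). [cite: GelbartPiatetskishapiroRallis1987, Part A §1] -/
theorem rank_toBlocks₂₁_le (F : Matrix (ι ⊕ ι) (ι ⊕ ι) L) : F.toBlocks₂₁.rank ≤ Fintype.card ι :=
  Matrix.rank_le_card_width _

/-- **The big cell is the top-rank cell**: `C` is invertible iff `rank C = n`. [folklore] -/
theorem isUnit_det_iff_rank_eq_card (C : Matrix ι ι L) : IsUnit C.det ↔ C.rank = Fintype.card ι := by
  constructor
  · intro h
    exact Matrix.rank_of_isUnit C ((Matrix.isUnit_iff_isUnit_det C).mpr h)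
  · intro h
    rw [← Matrix.isUnit_iff_isUnit_det, ← Matrix.mulVec_surjective_iff_isUnit, ← Matrix.coe_mulVecLin, ← LinearMap.range_eq_top]
    apply Submodule.eq_top_of_finrank_eq
    rw [Module.finrank_fintype_fun_eq_card]
    exact h

/-- **The small cell is the rank-zero cell**: `rank C = 0` iff `C = 0`. [folklore] -/
theorem rank_eq_zero_iff (C : Matrix ι ι L) : C.rank = 0 ↔ C = 0 := by
  constructor
  · intro h
    rw [Matrix.rank] at h
    have h1 : LinearMap.range C.mulVecLin = ⊥ := Submodule.finrank_eq_zero.mp h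
    have h2 : Matrix.toLin' C = 0 := by
      rw [Matrix.toLin'_apply']
      exact LinearMap.range_eq_bot.mp h1
    exact (LinearEquiv.map_eq_zero_iff _).mp h2
  · rintro rfl
    exact Matrix.rank_zero

end Field

end Summit.HodgeConjecture.HodgeConjecture.Cruxes.HLiu418.K2LiuSiegelBruhatCellsUnitary
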